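import Summits.QuantumFields.YangMills.Theorems.LuscherReductionTwistedTraceScalingRecordShadow
import Summits.QuantumFields.YangMills.Theorems.TwistedTraceScaling.Negative.SupportRecordRadiusThree
import HarnessLib

/-!
# The trivial eventual inequalities of `RecordBOInput` for `δ₁ = 14β^{-s}/|Site|`: `hδ₁`, `hcore` (the window condition `s < 1/5`), `hradii` (`K = 43`)
# (lane A of S-BASE, crux `TwistedTraceScaling` stmt-QuantumFields-20203, C4 INNER; design note `pub/ym-fleet/ym-luscher-20007-p1/COARSE-DESIGN.md` §24.9)

With the shadow radius `δ₁ β = 14·powScale s β/|Site 3 L|` of `recordChi_shadow` (p651108):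
* `recordDelta1_le_half` — `δ₁ ≤ 1/2` eventually (`hδ₁`);
* ★ `core_lt_recordDelta1` — `13·(L³β)^{-1/5} < δ₁ β` eventually iff (here: if) `s < 1/5` (`hcore`; rpow algebra: `β^{s−1/5} → 0`);
* `radii_recordDelta1` — `|Edge|·(4 r β + δ₁ β) < 43·powScale s β` eventually once `12·|Site|·r β < powScale s β` eventually (`hradii` with `K = 43`).
So for s ∈ (1/6, 1/5) the only fields of `RecordBOInput L s 43 M` not in the tree are the fibre profile `Ω` (with `r`) and the analytic bricks (B-T), (B-ST), (B-OD) (and the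
rate bookkeeping `κ`, `b`, `σ`, `θ₀` they come with).
HONEST FRAMING: bookkeeping for a stub of a child of the CONDITIONAL reduction route R2b1; analytic bricks OPEN; C4 OPEN; not a gap, not Clay.
-/

set_option autoImplicit false

noncomputable section

open MeasureTheory Filter Topology Real
open scoped BigOperators
open Literature.MathematicalPhysics.QuantumFieldTheory
open Literature.MathematicalPhysics.QuantumLattice

namespace Summit.QuantumFields.YangMills.Theorems.FemtoTransferGap.TwoLattice.ConstTube

open Summit.QuantumFields.YangMills.Theorems.FemtoTransferGap

variable {L : ℕ} [NeZero L]

variable (L) in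
/-- The record shadow radius `δ₁ β = 14·β^{-s}/|Site 3 L|`. [folklore] -/
def recordDelta1 (s : ℝ) (β : ℝ) : ℝ := 14 * powScale s β / Fintype.card (Site 3 L)

/-- `|Site 3 L|` as a real number is positive (`|Edge 3 L| = 3|Site 3 L|` is `…Negative.R36.card_edge_eq`). [folklore] -/
theorem card_site_pos : (0 : ℝ) < Fintype.card (Site 3 L) := by exact_mod_cast Fintype.card_pos

/-- `hδ₁`: `δ₁ ≤ 1/2` eventually (`s > 0`). [folklore] -/
theorem recordDelta1_le_half {s : ℝ} (hs : 0 < s) : ∀ᶠ β : ℝ in atTop, recordDelta1 L s β ≤ 1 / 2 := by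
  have hN := card_site_pos (L := L)
  have hN1 : (1 : ℝ) ≤ Fintype.card (Site 3 L) := by exact_mod_cast Fintype.card_pos
  filter_upwards [(tendsto_powScale hs).eventually (gt_mem_nhds (show (0 : ℝ) < 1 / 28 by norm_num))] with β hβ
  unfold recordDelta1
  rw [div_le_iff₀ hN]
  nlinarith [powScale_pos s β]

/-- ★ `hcore`: `13·(L³β)^{-1/5} < δ₁ β` eventually, for `0 < s < 1/5`. [folklore] -/
theorem core_lt_recordDelta1 {s : ℝ} (hs : 0 < s) (hs5 : s < 1 / 5) :
    ∀ᶠ β : ℝ in atTop, 13 * ((L : ℝ) ^ 3 * β) ^ (-(1 / 5 : ℝ)) < recordDelta1 L s β := by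
  have hN := card_site_pos (L := L)
  have hL : (1 : ℝ) ≤ (L : ℝ) := by exact_mod_cast NeZero.one_le
  have hL3 : (1 : ℝ) ≤ (L : ℝ) ^ 3 := one_le_pow₀ hL
  -- `β^{s − 1/5} → 0`
  have ht : Tendsto (fun β : ℝ => β ^ (-(1 / 5 - s))) atTop (𝓝 0) := tendsto_rpow_neg_atTop (by linarith)
  set c : ℝ := 14 / (13 * Fintype.card (Site 3 L)) with hc
  have hc0 : 0 < c := by rw [hc]; positivity
  filter_upwards [ht.eventually (gt_mem_nhds hc0), Filter.eventually_ge_atTop (1 : ℝ)] with β hβ hβ1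
  have hβ0 : 0 < β := by linarith
  unfold recordDelta1
  rw [powScale_eq hβ1]
  -- `(L³β)^{-1/5} ≤ β^{-1/5}`
  have h1 : ((L : ℝ) ^ 3 * β) ^ (-(1 / 5 : ℝ)) ≤ β ^ (-(1 / 5 : ℝ)) := by
    rw [Real.rpow_neg (by positivity), Real.rpow_neg hβ0.le]
    refine inv_anti₀ (Real.rpow_pos_of_pos hβ0 _) (Real.rpow_le_rpow hβ0.le (by nlinarith) (by norm_num))
  -- `β^{-1/5} = β^{-(1/5 - s)} · β^{-s}`
  have h2 : β ^ (-(1 / 5 : ℝ)) = β ^ (-(1 / 5 - s)) * β ^ (-s) := by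
    rw [← Real.rpow_add hβ0]; ring_nf
  have hβs : 0 < β ^ (-s) := Real.rpow_pos_of_pos hβ0 _
  have h3 : 13 * (β ^ (-(1 / 5 - s)) * β ^ (-s)) < 14 * β ^ (-s) / Fintype.card (Site 3 L) := by
    rw [lt_div_iff₀ hN]
    have := mul_lt_mul_of_pos_right hβ hβs
    rw [hc] at this
    have e : 14 / (13 * (Fintype.card (Site 3 L) : ℝ)) * β ^ (-s) * (13 * Fintype.card (Site 3 L)) = 14 * β ^ (-s) := by
      field_simp
    nlinarith [this, e]
  calc 13 * ((L : ℝ) ^ 3 * β) ^ (-(1 / 5 : ℝ)) ≤ 13 * β ^ (-(1 / 5 : ℝ)) := by linarith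
    _ = 13 * (β ^ (-(1 / 5 - s)) * β ^ (-s)) := by rw [h2]
    _ < 14 * β ^ (-s) / Fintype.card (Site 3 L) := h3

/-- `hradii` with `K = 43`: `|Edge|·(4 r β + δ₁ β) < 43·β^{-s}` eventually, once `12|Site|·r β < β^{-s}` eventually. [folklore] -/
theorem radii_recordDelta1 {s : ℝ} {r : ℝ → ℝ} (hr : ∀ᶠ β : ℝ in atTop, 12 * Fintype.card (Site 3 L) * r β < powScale s β) :
    ∀ᶠ β : ℝ in atTop, (Fintype.card (Edge 3 L) : ℝ) * (4 * r β + recordDelta1 L s β) < 43 * powScale s β := by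
  have hN := card_site_pos (L := L)
  filter_upwards [hr] with β hβ
  unfold recordDelta1
  rw [TwistedTraceScaling.Negative.R36.card_edge_eq]
  have e : 3 * (Fintype.card (Site 3 L) : ℝ) * (4 * r β + 14 * powScale s β / Fintype.card (Site 3 L)) = 12 * Fintype.card (Site 3 L) * r β + 42 * powScale s β := by
    field_simp
    ring
  rw [e]
  linarith

/-- The three fields together, in the shape of `RecordBOInput` (`K = 43`, `δ₁ = recordDelta1 L s`). [folklore] -/
theorem record_structural_inequalities {s : ℝ} (hs : 0 < s) (hs5 : s < 1 / 5) {r : ℝ → ℝ}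
    (hr : ∀ᶠ β : ℝ in atTop, 12 * Fintype.card (Site 3 L) * r β < powScale s β) :
    (∀ᶠ β : ℝ in atTop, recordDelta1 L s β ≤ 1 / 2) ∧
      (∀ᶠ β : ℝ in atTop, 13 * ((L : ℝ) ^ 3 * β) ^ (-(1 / 5 : ℝ)) < recordDelta1 L s β) ∧
      (∀ᶠ β : ℝ in atTop, (Fintype.card (Edge 3 L) : ℝ) * (4 * r β + recordDelta1 L s β) < 43 * powScale s β) ∧
      ∀ K M : ℝ, 0 ≤ K → 0 ≤ M → ∀ᶠ β : ℝ in atTop, ∀ U : GaugeConfig 3 L SU2, recordChi L s K M β U ≠ 0 → orbitDist U < powScale s β →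
        orbitDist (slowMean L U) < recordDelta1 L s β :=
  ⟨recordDelta1_le_half hs, core_lt_recordDelta1 hs hs5, radii_recordDelta1 hr, fun _ _ hK hM => recordChi_shadow hs hK hM⟩

end Summit.QuantumFields.YangMills.Theorems.FemtoTransferGap.TwoLattice.ConstTube

end
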